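import Summits.Langlands.Langlands.Theorems.IrreducibilityBySelfDualityReciprocityUpToIrreducibilityTightnessAbove
import Summits.Langlands.Langlands.Theorems.IrreducibilityBySelfDualityReciprocityUpToIrreducibilityWeakExistence
import Literature.NumberTheory.PAdicHodge.FontaineDpst
import Literature.NumberTheory.GaloisRepresentations.WeilDeligneOfGaloisUnramifiedProofs
import Literature.NumberTheory.Automorphic.LocalLanglandsGLOne
import Literature.NumberTheory.Automorphic.GLOneOfHeckeCharacterBJ
import HarnessLib

/-!
# Line `Sketch` for the crux `ReciprocityUpToIrreducibility` (item stmt-Langlands-14328), continuation c3: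
# the `v ∣ ℓ` clause on the UNRAMIFIED sector after clause (F8) of Fontaine's specification

Support file (closes nothing; continuation lead c3, prover-line-stmt-Langlands-14328-c3-0).

The registered open stub `stub_pairCompatibilityAbove` of line `Sketch` (local–global compatibility at
the places `v ∣ ℓ`, through Fontaine's PINNED datum `fontainePstAdicCompletion v ℓ hv =
Classical.epsilon (IsFontaineDatum _)`) was recorded by the crux's disprover (cdisprove cycle 1,
`Negative/PinnedFontaineDatumUndecided`, 13:30Z) as formally undecidable in the tree: the clauses
(F1)–(F7) of `IsFontaineDatum` did not pin the Weil–Deligne representation the datum attaches to the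
trivial representation, while the crux decides it.  At 17:19Z the specification GAINED clause (F8)
`IsFontaineDatum.isEquivalent_weilRestrict_of_isLocallyUnramified` (Fontaine 1994, Exp. VIII §1.3,
§2.3.7: for unramified `ρ`, `WD(D_pst ρ) ≅ (ρ|_{W_F}, N = 0)`).  This file draws the consequences for
the line, all under the T0 named fact `FontaineDatumExists` (the only thing that makes the `ε`-term
satisfy its specification):

* `exists_isTransportAlong` — every Weil–Deligne representation on `Eⁿ` has a transport along any
  ring homomorphism `ι : E →+* C` (entrywise image of matrices; needed to exhibit the complex
  representation `rℂ = ι(r)` of the summit's `LocalGlobalCompatibleAt`).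
* `fontainePstAdicCompletion_isWeilDeligneOf_of_isUnramifiedAt` — (F8) at the summit's places: for
  `ρ : Γ_K → GL_n(ℚ̄_ℓ)` unramified at `v ∣ ℓ`, the pinned datum attaches SOME `r` to `ρ|_{Γ_{K_v}}`, and
  every attached `r` is `≅ (ρ|_{W_{K_v}}, 0)`.
* `localGlobalCompatibleAt_above_iff_of_isUnramifiedAt` — **on the unramified-at-`v` sector the
  `v ∣ ℓ` clause of `LocalGlobalCompatibleAt` is EQUIVALENT to the `ℓ`-blind statement** "some local
  component `π_v` of `π` has `rec_v(π_v) =` the Frobenius-semisimple class of `ι(ρ|_{W_{K_v}}, 0)`" —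
  literally the content of the clause at a place `v ∤ ℓ` where `ρ` is unramified (there the
  Grothendieck–Deligne recipe `IsWeilDeligneOfLadic` forces `r = (ρ|_{W}, 0)` as matrices,
  `IsWeilDeligneOfLadic.toMatrix'_ρ_eq_of_forall_inertia`); in particular
  `localGlobalCompatibleAt_above_of_isWeilDeligneOfLadic`: Grothendieck–Deligne data for `ρ|_{W_{K_v}}`
  at `v ∣ ℓ` ALSO witness the `v ∣ ℓ` clause.
* `fontainePstAdicCompletion_isWeilDeligneOf_one_trivial` — the clause `WDT` of the disprover
  ("the pinned datum attaches the trivial Weil–Deligne representation to `1`", every rank) is now a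
  THEOREM under `FontaineDatumExists`; so the witness `(π_𝟙, ρ = 1)` of
  `Negative/PinnedFontaineDatumUndecided` no longer separates the pinned datum from the specification.

Consequence for the line: the `ε`-obstruction to `stub_pairCompatibilityAbove` has receded from "every
instance, even `ρ = 1`" to the ramified-at-`v` / non-zero-weight sector ((F1)–(F8) do not pin the
Frobenius eigenvalue of `WD(ℚ_ℓ(k))`, `k ≠ 0`, docstring of `FontaineDpst`).  No definitions; std axioms.
-/

noncomputable section

set_option linter.dupNamespace false -- project-wide option (lakefile weak.linter.dupNamespace); `Summit.Langlands.Langlands` is the mandated namespace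

open scoped MatrixGroups Matrix NumberField Classical
open Filter IsDedekindDomain Field
open Literature.NumberTheory.Automorphic Literature.NumberTheory.GaloisRepresentations
open Literature.NumberTheory.PAdicHodge
open Summit.Langlands

namespace Summit.Langlands.Langlands.Theorems.ReciprocityUpToIrreducibility

/-! ## 1. Transport of a Weil–Deligne representation along a ring homomorphism -/

section Transport

variable {F : Type} [Field F] [ValuativeRel F] [TopologicalSpace F] [IsNonarchimedeanLocalField F]
  {E : Type*} [Field E] [CharZero E] {C : Type*} [Field C] [CharZero C] {n : ℕ}

/-- **Transport along `ι` exists.**  For a Weil–Deligne representation `r = (ρ, N)` on `Eⁿ` and a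
ring homomorphism `ι : E →+* C` (e.g. `ι : ℚ̄_ℓ ≃ ℂ`), the pair `(ι ∘ ρ, ι N)` of entrywise images of
matrices is a Weil–Deligne representation on `Cⁿ` (continuity, nilpotency and the relation
`ρ(w) N = q^{deg w} N ρ(w)` pass through the ring homomorphism `f ↦ toLin' ((toMatrix' f).map ι)` of
endomorphism rings), and it is a transport of `r` along `ι` in the sense of the accepted
`WeilDeligneRep.IsTransportAlong`. [cite: DeligneAntwerpII1973, §8.4.3] -/
theorem exists_isTransportAlong (ι : E →+* C) (r : WeilDeligneRep F E (Fin n → E)) :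
    ∃ r' : WeilDeligneRep F C (Fin n → C), r.IsTransportAlong ι r' := by
  -- the transport of endomorphisms `f ↦ toLin' ((toMatrix' f).map ι)`, a ring homomorphism
  let Φ : Module.End E (Fin n → E) →+* Module.End C (Fin n → C) :=
    (Matrix.toLinAlgEquiv' : Matrix (Fin n) (Fin n) C ≃ₐ[C] _).toRingEquiv.toRingHom.comp
      ((ι.mapMatrix : Matrix (Fin n) (Fin n) E →+* Matrix (Fin n) (Fin n) C).comp
        (LinearMap.toMatrixAlgEquiv' : Module.End E (Fin n → E) ≃ₐ[E] _).toRingEquiv.toRingHom)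
  have hΦmat : ∀ f, LinearMap.toMatrix' (Φ f) = (LinearMap.toMatrix' f).map ι := fun f => by
    show LinearMap.toMatrixAlgEquiv'
      (Matrix.toLinAlgEquiv' (ι.mapMatrix (LinearMap.toMatrixAlgEquiv' f))) = _
    rw [LinearMap.toMatrixAlgEquiv'_toLinAlgEquiv', RingHom.mapMatrix_apply]
    rfl
  have hΦsmul : ∀ (c : E) (f : Module.End E (Fin n → E)), Φ (c • f) = ι c • Φ f := fun c f => by
    refine LinearMap.toMatrix'.injective ?_
    rw [hΦmat, LinearEquiv.map_smul, LinearEquiv.map_smul, hΦmat]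
    ext i j
    simp [Matrix.map_apply]
  refine ⟨{ ρ := Φ.toMonoidHom.comp r.ρ
            isContinuous := ?_
            N := Φ r.N
            isNilpotent_N := r.isNilpotent_N.map Φ
            conj_N := fun w => ?_ }, fun w => hΦmat _, hΦmat _⟩
  · obtain ⟨U, hU, hUo, hker⟩ := r.isContinuous
    refine ⟨U, hU, hUo, fun u hu => ?_⟩
    show Φ (r.ρ u) = 1
    rw [hker u hu, map_one]
  · show Φ (r.ρ w) ∘ₗ Φ r.N =
      ((IsNonarchimedeanLocalField.residueFieldCard F : C) ^ WeilGroup.deg w) • (Φ r.N ∘ₗ Φ (r.ρ w))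
    rw [← Module.End.mul_eq_comp, ← Module.End.mul_eq_comp, ← map_mul, ← map_mul,
      Module.End.mul_eq_comp, Module.End.mul_eq_comp, r.conj_N w, hΦsmul, map_zpow₀, map_natCast]

/-- A Weil–Deligne representation isomorphic to a trivial one IS the trivial one (its `ρ(w)` are
conjugate to the identity and its `N` to `0`). [cite: TateCorvallis1979, (4.1.3)] -/
theorem eq_trivial_of_isEquivalent_trivial {V : Type*} [AddCommGroup V] [Module C V]
    {W : Type*} [AddCommGroup W] [Module C W]
    {r : WeilDeligneRep F C V} (h : r.IsEquivalent (WeilDeligneRep.trivial C W)) :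
    r = WeilDeligneRep.trivial C V := by
  obtain ⟨e⟩ := h
  have hinj : Function.Injective e.toLinearEquiv := e.toLinearEquiv.injective
  have hρ : ∀ w, r.ρ w = LinearMap.id := fun w => by
    refine LinearMap.ext fun x => hinj ?_
    have h1 := congrArg (fun f => f x) (e.toRepEquiv.isIntertwining' w)
    simpa [WeilDeligneRep.trivial] using h1
  have hN : r.N = 0 := by
    refine LinearMap.ext fun x => hinj ?_
    have h1 := congrArg (fun f => f x) e.comm_N
    simpa [WeilDeligneRep.trivial] using h1
  cases r with
  | mk ρ hc N hnil hconj =>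
    have hρ' : ρ = Representation.trivial C (WeilGroup F) V := MonoidHom.ext fun w => hρ w
    have hN' : N = 0 := hN
    subst hρ' hN'
    rfl

end Transport

/-! ## 2. (F8) at the summit's places `v ∣ ℓ` -/

section Summit

variable {K : Type} [Field K] [NumberField K] {ℓ : ℕ} [Fact ℓ.Prime] {n : ℕ}

/-- **(F8) for the summit's pinned datum.**  Under `FontaineDatumExists`, for `ρ : Γ_K → GL_n(ℚ̄_ℓ)`
unramified at a place `v ∣ ℓ` the pinned datum `fontainePstAdicCompletion v ℓ hv` attaches SOME
Weil–Deligne representation to `ρ|_{Γ_{K_v}}` (unramified ⇒ de Rham ⇒ `exists_of_isDeRham`), and every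
attached one is isomorphic to `(ρ|_{W_{K_v}}, N = 0)` (clause (F8), Fontaine 1994, Exp. VIII §1.3,
§2.3.7). [cite: FontaineAsterisque223VIII, §1.3 and §2.3.7] -/
theorem fontainePstAdicCompletion_isWeilDeligneOf_of_isUnramifiedAt (hF : FontaineDatumExists)
    (ρ : FramedGaloisRep K (PadicAlgCl ℓ) n) {v : HeightOneSpectrum (𝓞 K)} (hρ : ρ.IsUnramifiedAt v)
    (hv : ((ℓ : ℕ) : 𝓞 K) ∈ v.asIdeal) :
    (∃ r, (fontainePstAdicCompletion v ℓ hv).IsWeilDeligneOf (ρ.toLocal v) r) ∧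
      ∀ r, (fontainePstAdicCompletion v ℓ hv).IsWeilDeligneOf (ρ.toLocal v) r →
        r.IsEquivalent (WeilDeligneRep.ofRep ((ρ.toLocal v).weilRestrict (v.adicCompletion K))
          (isLocallyUnramified_toLocal_of_isUnramifiedAt ρ v hρ).isUnramifiedRep_weilRestrict.isContinuousRep) := by
  haveI := LocalField.charZero_adicCompletion v
  exact (isFontaineDatum_fontainePstAdicCompletion hF v ℓ hv).isWeilDeligneOf_of_isLocallyUnramified
    (isLocallyUnramified_toLocal_of_isUnramifiedAt ρ v hρ)

/-- **The disprover's clause `WDT` is now a theorem.**  Under `FontaineDatumExists`, at every place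
`v ∣ ℓ` of every number field the pinned datum attaches the TRIVIAL Weil–Deligne representation to the
trivial rank-`n` representation of `Γ_{K_v}` (by (F8) every attached `r` is `≅ (1, 0)`, and a
Weil–Deligne representation isomorphic to the trivial one is trivial).  This is the statement
`Negative/PinnedFontaineDatumUndecided` showed the crux decides and (F1)–(F7) do not.
[cite: FontaineAsterisque223VIII, §1.3] -/
theorem fontainePstAdicCompletion_isWeilDeligneOf_one_trivial (hF : FontaineDatumExists)
    (v : HeightOneSpectrum (𝓞 K)) (hv : ((ℓ : ℕ) : 𝓞 K) ∈ v.asIdeal) :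
    (fontainePstAdicCompletion v ℓ hv).IsWeilDeligneOf
      (1 : FramedRep (absoluteGaloisGroup (v.adicCompletion K)) (PadicAlgCl ℓ) n)
      (WeilDeligneRep.trivial (PadicAlgCl ℓ) (Fin n → PadicAlgCl ℓ)) := by
  haveI := LocalField.charZero_adicCompletion v
  have hFD := isFontaineDatum_fontainePstAdicCompletion hF v ℓ hv
  obtain ⟨⟨r, hr⟩, -⟩ := hFD.isWeilDeligneOf_of_isLocallyUnramified
    (FramedRep.isLocallyUnramified_one (n := n))
  have he := hFD.isEquivalent_trivial_of_isWeilDeligneOf_one hr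
  rwa [eq_trivial_of_isEquivalent_trivial he] at hr

variable {hcpt : isCompact_glFiniteIntegralLevel n K}

/-- **Unramified sector, `⇐`: the `ℓ`-blind matching gives local–global compatibility above `ℓ`.**
Under `FontaineDatumExists`, let `ρ` be unramified at `v ∣ ℓ`, `π_v` a local component of `π` at `v`,
and `rℂ` a transport along `ι` of `(ρ|_{W_{K_v}}, 0)` whose Frobenius-semisimplification has class
`rec_v(π_v)`.  Then `LocalGlobalCompatibleAt Rec ι π ρ v`: the datum attaches some `r₀ ≅ (ρ|_{W}, 0)`
((F8)); transport `r₀` along `ι` (`exists_isTransportAlong`); isomorphic representations have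
isomorphic transports (`isEquivalent_of_isTransportAlong`) and the Frobenius-semisimple class is an
isomorphism invariant (`hasFrobSemisimpleClass_of_isEquivalent`). [cite: FontaineAsterisque223VIII, §2.3.7]
[cite: DeligneAntwerpII1973, §8.4.3 and §8.6] -/
theorem localGlobalCompatibleAt_above_of_isUnramifiedAt (hF : FontaineDatumExists)
    (Rec : ReciprocityData K) (ι : PadicAlgCl ℓ ≃+* ℂ)
    (π : AutomorphicRepData (AutomorphyDatum.gl n K hcpt)) (ρ : FramedGaloisRep K (PadicAlgCl ℓ) n)
    {v : HeightOneSpectrum (𝓞 K)} (hv : ((ℓ : ℕ) : 𝓞 K) ∈ v.asIdeal) (hρ : ρ.IsUnramifiedAt v)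
    (πv : SmoothIrrep (GL (Fin n) (v.adicCompletion K))) (hπv : π.HasLocalComponentAt v πv.ρ)
    (rℂ : WeilDeligneRep (v.adicCompletion K) ℂ (Fin n → ℂ))
    (htr : (WeilDeligneRep.ofRep ((ρ.toLocal v).weilRestrict (v.adicCompletion K))
      (isLocallyUnramified_toLocal_of_isUnramifiedAt ρ v hρ).isUnramifiedRep_weilRestrict.isContinuousRep).IsTransportAlong
        (ι : PadicAlgCl ℓ →+* ℂ) rℂ)
    (hcls : rℂ.HasFrobSemisimpleClass ((Rec.llc v).recGL n (IrrClass.mk πv))) :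
    LocalGlobalCompatibleAt Rec ι π ρ v := by
  obtain ⟨⟨r₀, hr₀⟩, huniq⟩ := fontainePstAdicCompletion_isWeilDeligneOf_of_isUnramifiedAt hF ρ hρ hv
  obtain ⟨rℂ₀, htr₀⟩ := exists_isTransportAlong (ι : PadicAlgCl ℓ →+* ℂ) r₀
  obtain ⟨e⟩ := isEquivalent_of_isTransportAlong _ (huniq r₀ hr₀) htr₀ htr
  exact ⟨πv, r₀, rℂ₀, hπv, fun h => absurd hv h, fun _ => hr₀, htr₀,
    hasFrobSemisimpleClass_of_isEquivalent ⟨e.symm⟩ hcls⟩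

/-- **Unramified sector, `⇒`.**  Conversely, under `FontaineDatumExists`, local–global compatibility
at `v ∣ ℓ` for `ρ` unramified at `v` yields a local component `π_v` and a transport `rℂ` of
`(ρ|_{W_{K_v}}, 0)` along `ι` with `rℂ^{F-ss}` of class `rec_v(π_v)` (the attached `r` of the clause is
`≅ (ρ|_{W}, 0)` by (F8)). [cite: FontaineAsterisque223VIII, §2.3.7] [cite: DeligneAntwerpII1973, §8.6] -/
theorem exists_of_localGlobalCompatibleAt_above_of_isUnramifiedAt (hF : FontaineDatumExists)
    (Rec : ReciprocityData K) (ι : PadicAlgCl ℓ ≃+* ℂ)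
    (π : AutomorphicRepData (AutomorphyDatum.gl n K hcpt)) (ρ : FramedGaloisRep K (PadicAlgCl ℓ) n)
    {v : HeightOneSpectrum (𝓞 K)} (hv : ((ℓ : ℕ) : 𝓞 K) ∈ v.asIdeal) (hρ : ρ.IsUnramifiedAt v)
    (h : LocalGlobalCompatibleAt Rec ι π ρ v) :
    ∃ (πv : SmoothIrrep (GL (Fin n) (v.adicCompletion K)))
      (rℂ : WeilDeligneRep (v.adicCompletion K) ℂ (Fin n → ℂ)),
      π.HasLocalComponentAt v πv.ρ ∧
        (WeilDeligneRep.ofRep ((ρ.toLocal v).weilRestrict (v.adicCompletion K))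
          (isLocallyUnramified_toLocal_of_isUnramifiedAt ρ v hρ).isUnramifiedRep_weilRestrict.isContinuousRep).IsTransportAlong
            (ι : PadicAlgCl ℓ →+* ℂ) rℂ ∧
        rℂ.HasFrobSemisimpleClass ((Rec.llc v).recGL n (IrrClass.mk πv)) := by
  obtain ⟨πv, r, rℂ, hπv, -, hpst, htr, hcls⟩ := h
  have he := (fontainePstAdicCompletion_isWeilDeligneOf_of_isUnramifiedAt hF ρ hρ hv).2 r (hpst hv)
  obtain ⟨rℂ₁, htr₁⟩ := exists_isTransportAlong (ι : PadicAlgCl ℓ →+* ℂ)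
    (WeilDeligneRep.ofRep ((ρ.toLocal v).weilRestrict (v.adicCompletion K))
      (isLocallyUnramified_toLocal_of_isUnramifiedAt ρ v hρ).isUnramifiedRep_weilRestrict.isContinuousRep)
  exact ⟨πv, rℂ₁, hπv, htr₁,
    hasFrobSemisimpleClass_of_isEquivalent (isEquivalent_of_isTransportAlong _ he htr htr₁) hcls⟩

/-- **On the unramified-at-`v` sector the `v ∣ ℓ` clause is the `ℓ`-blind matching** (under
`FontaineDatumExists`): for `ρ` unramified at `v ∣ ℓ`, `LocalGlobalCompatibleAt Rec ι π ρ v` holds iff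
some local component `π_v` of `π` at `v` has `rec_v(π_v)` equal to the Frobenius-semisimple class of a
transport of `(ρ|_{W_{K_v}}, N = 0)` along `ι` — the same statement the clause makes at a place
`v ∤ ℓ` where `ρ` is unramified.  So, after (F8), `stub_pairCompatibilityAbove` restricted to
representations unramified above `ℓ` is no longer formally blocked on the construction of `WD ∘ D_pst`.
[cite: FontaineAsterisque223VIII, §2.3.7] [cite: BuzzardGeeLMS2014, Conj. 3.2.2] -/
theorem localGlobalCompatibleAt_above_iff_of_isUnramifiedAt (hF : FontaineDatumExists)
    (Rec : ReciprocityData K) (ι : PadicAlgCl ℓ ≃+* ℂ)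
    (π : AutomorphicRepData (AutomorphyDatum.gl n K hcpt)) (ρ : FramedGaloisRep K (PadicAlgCl ℓ) n)
    {v : HeightOneSpectrum (𝓞 K)} (hv : ((ℓ : ℕ) : 𝓞 K) ∈ v.asIdeal) (hρ : ρ.IsUnramifiedAt v) :
    LocalGlobalCompatibleAt Rec ι π ρ v ↔
      ∃ (πv : SmoothIrrep (GL (Fin n) (v.adicCompletion K)))
        (rℂ : WeilDeligneRep (v.adicCompletion K) ℂ (Fin n → ℂ)),
        π.HasLocalComponentAt v πv.ρ ∧
          (WeilDeligneRep.ofRep ((ρ.toLocal v).weilRestrict (v.adicCompletion K))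
            (isLocallyUnramified_toLocal_of_isUnramifiedAt ρ v hρ).isUnramifiedRep_weilRestrict.isContinuousRep).IsTransportAlong
              (ι : PadicAlgCl ℓ →+* ℂ) rℂ ∧
          rℂ.HasFrobSemisimpleClass ((Rec.llc v).recGL n (IrrClass.mk πv)) :=
  ⟨exists_of_localGlobalCompatibleAt_above_of_isUnramifiedAt hF Rec ι π ρ hv hρ,
    fun ⟨πv, rℂ, hπv, htr, hcls⟩ =>
      localGlobalCompatibleAt_above_of_isUnramifiedAt hF Rec ι π ρ hv hρ πv hπv rℂ htr hcls⟩

/-- **Grothendieck–Deligne data witness the `v ∣ ℓ` clause on the unramified sector.**  Under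
`FontaineDatumExists`, if `ρ` is unramified at `v ∣ ℓ` and `(π_v, r, rℂ)` satisfy the three `ℓ`-blind
conjuncts of `LocalGlobalCompatibleAt` with the `v ∤ ℓ` recipe — `r` attached to `ρ|_{W_{K_v}}` by
`IsWeilDeligneOfLadic`, `rℂ = ι(r)`, `rℂ^{F-ss}` of class `rec_v(π_v)` — then
`LocalGlobalCompatibleAt Rec ι π ρ v`.  (For `ρ|_{W}` trivial on inertia the recipe returns
`(ρ|_{W}, 0)` itself as matrices, `IsWeilDeligneOfLadic.toMatrix'_ρ_eq_of_forall_inertia`, i.e. `r` IS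
`(ρ|_{W_{K_v}}, 0)`; then `localGlobalCompatibleAt_above_of_isUnramifiedAt`.)  This is the precise sense
in which (F8) makes the pinned datum agree with the `ℓ ≠ p` recipe the summit uses away from `ℓ`.
[cite: DeligneAntwerpII1973, §8.4.2] [cite: FontaineAsterisque223VIII, §2.3.7] -/
theorem localGlobalCompatibleAt_above_of_isWeilDeligneOfLadic (hF : FontaineDatumExists)
    (Rec : ReciprocityData K) (ι : PadicAlgCl ℓ ≃+* ℂ)
    (π : AutomorphicRepData (AutomorphyDatum.gl n K hcpt)) (ρ : FramedGaloisRep K (PadicAlgCl ℓ) n)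
    {v : HeightOneSpectrum (𝓞 K)} (hv : ((ℓ : ℕ) : 𝓞 K) ∈ v.asIdeal) (hρ : ρ.IsUnramifiedAt v)
    (πv : SmoothIrrep (GL (Fin n) (v.adicCompletion K))) (hπv : π.HasLocalComponentAt v πv.ρ)
    (r : WeilDeligneRep (v.adicCompletion K) (PadicAlgCl ℓ) (Fin n → PadicAlgCl ℓ))
    (hlad : IsWeilDeligneOfLadic (ρ.toLocal v).toWeilGroupHom r)
    (rℂ : WeilDeligneRep (v.adicCompletion K) ℂ (Fin n → ℂ))
    (htr : r.IsTransportAlong (ι : PadicAlgCl ℓ →+* ℂ) rℂ)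
    (hcls : rℂ.HasFrobSemisimpleClass ((Rec.llc v).recGL n (IrrClass.mk πv))) :
    LocalGlobalCompatibleAt Rec ι π ρ v := by
  have hI := ρ.toWeilGroupHom_toLocal_eq_one_of_isUnramifiedAt hρ
  -- the recipe returns `(ρ|_{W}, 0)` itself
  have hr : r = WeilDeligneRep.ofRep ((ρ.toLocal v).weilRestrict (v.adicCompletion K))
      (isLocallyUnramified_toLocal_of_isUnramifiedAt ρ v hρ).isUnramifiedRep_weilRestrict.isContinuousRep := by
    have hN : r.N = 0 := hlad.N_eq_zero_of_forall_inertia hI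
    have hρW : ∀ w, r.ρ w = (ρ.toLocal v).weilRestrict (v.adicCompletion K) w := fun w => by
      have h1 := hlad.toMatrix'_ρ_eq_of_forall_inertia hI w
      have h2 : r.ρ w = Matrix.toLin' (LinearMap.toMatrix' (r.ρ w)) := (Matrix.toLin'_toMatrix' _).symm
      rw [h2, h1]
      refine LinearMap.ext fun x => ?_
      rw [Matrix.toLin'_apply, FramedRep.weilRestrict_apply_apply, FramedRep.toWeilGroupHom_apply]
    cases r with
    | mk ρr hc N hnil hconj =>
      have h1 : ρr = (ρ.toLocal v).weilRestrict (v.adicCompletion K) := MonoidHom.ext fun w => hρW w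
      have h2 : N = 0 := hN
      subst h1 h2
      rfl
  subst hr
  exact localGlobalCompatibleAt_above_of_isUnramifiedAt hF Rec ι π ρ hv hρ πv hπv rℂ htr hcls

/-- **Registered stub `stub_aboveUnramified_of_isWeilDeligneOfLadic` of line `Sketch` (crux
stmt-Langlands-14328), closed form of `localGlobalCompatibleAt_above_of_isWeilDeligneOfLadic`**: under
`FontaineDatumExists`, at a place `v ∣ ℓ` where `ρ` is unramified, Grothendieck–Deligne data
`(π_v, r, rℂ)` for `ρ|_{W_{K_v}}` witness the `v ∣ ℓ` clause of `LocalGlobalCompatibleAt` — the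
unramified sector of `stub_pairCompatibilityAbove` has the shape of LGC-away.
[cite: FontaineAsterisque223VIII, §2.3.7] [cite: DeligneAntwerpII1973, §8.4.2] -/
theorem stub_aboveUnramified_of_isWeilDeligneOfLadic :
    FontaineDatumExists → ∀ (K : Type) [Field K] [NumberField K] (ℓ : ℕ) [Fact ℓ.Prime] (n : ℕ)
      (hcpt : isCompact_glFiniteIntegralLevel n K) (Rec : ReciprocityData K) (ι : PadicAlgCl ℓ ≃+* ℂ)
      (π : AutomorphicRepData (AutomorphyDatum.gl n K hcpt)) (ρ : FramedGaloisRep K (PadicAlgCl ℓ) n)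
      (v : HeightOneSpectrum (𝓞 K)), ((ℓ : ℕ) : 𝓞 K) ∈ v.asIdeal → ρ.IsUnramifiedAt v →
      ∀ (πv : SmoothIrrep (GL (Fin n) (v.adicCompletion K))), π.HasLocalComponentAt v πv.ρ →
      ∀ (r : WeilDeligneRep (v.adicCompletion K) (PadicAlgCl ℓ) (Fin n → PadicAlgCl ℓ)),
        IsWeilDeligneOfLadic (ρ.toLocal v).toWeilGroupHom r →
      ∀ (rℂ : WeilDeligneRep (v.adicCompletion K) ℂ (Fin n → ℂ)),
        r.IsTransportAlong (ι : PadicAlgCl ℓ →+* ℂ) rℂ →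
        rℂ.HasFrobSemisimpleClass ((Rec.llc v).recGL n (IrrClass.mk πv)) →
        LocalGlobalCompatibleAt Rec ι π ρ v :=
  fun hF _ _ _ _ _ _ _ Rec ι π ρ _ hv hρ πv hπv r hlad rℂ htr hcls =>
    localGlobalCompatibleAt_above_of_isWeilDeligneOfLadic hF Rec ι π ρ hv hρ πv hπv r hlad rℂ htr hcls

/-! ## 3. The disprover's witness pair `(π_𝟙, ρ = 1)` IS locally–globally compatible above `ℓ` -/

/-- The trivial Weil–Deligne representation on `Cⁿ` is Frobenius-semisimple. [folklore] -/
theorem isFrobSemisimple_trivial {F : Type} [Field F] [ValuativeRel F] [TopologicalSpace F]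
    [IsNonarchimedeanLocalField F] {C : Type*} [Field C] [CharZero C] (m : ℕ) :
    (WeilDeligneRep.trivial C (Fin m → C) : WeilDeligneRep F C (Fin m → C)).IsFrobSemisimple :=
  fun _ => Module.End.isSemisimple_id

/-- **`(π_𝟙, 1)` is locally–globally compatible at every `v ∣ ℓ`, for EVERY reciprocity datum** (under
`FontaineDatumExists`).  Here `π_𝟙 = ℂ·1/⊥` is the trivial automorphic character of `GL₁(𝔸_K)`
(`W = ℂ · (1 ∘ det)`, `W' = ⊥`, as in `Negative/TrivialCharacterLocalGlobal.exists_trivial_cuspidal`):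
its local component at `v` is the trivial character `SmoothIrrep.ofQuasiChar 1` (the line
`c ↦ c · (1 ∘ det)` is a local component map), `rec_v` of it is `(1 ∘ artin, 0)` (`gl_one`), i.e. the
trivial class, and by (F8) the pinned datum attaches `(1, 0)` to `1|_{Γ_{K_v}}`
(`localGlobalCompatibleAt_above_of_isUnramifiedAt` with `rℂ` trivial).  The disprover showed the crux
PROVES this instance of the `v ∣ ℓ` clause (`Negative/PinnedFontaineDatumUndecided`); after (F8) the
instance is simply true. [cite: FontaineAsterisque223VIII, §1.3] [cite: TateCorvallis1979, (4.1.3)] -/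
theorem localGlobalCompatibleAt_trivial_above (hF : FontaineDatumExists)
    {hcpt₁ : isCompact_glFiniteIntegralLevel 1 K}
    {π : AutomorphicRepData (AutomorphyDatum.gl 1 K hcpt₁)}
    (hW : π.W = Submodule.span ℂ {fun g : (AdelicGroupData.gl 1 K).Adelic =>
      (detTwist 1 (1 : HeckeCharacter K) g : ℂ)})
    (hW' : π.W' = ⊥) (Rec : ReciprocityData K) (ι : PadicAlgCl ℓ ≃+* ℂ)
    (v : HeightOneSpectrum (𝓞 K)) (hv : ((ℓ : ℕ) : 𝓞 K) ∈ v.asIdeal) :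
    LocalGlobalCompatibleAt Rec ι π (1 : FramedGaloisRep K (PadicAlgCl ℓ) 1) v := by
  classical
  have hd1 : ∀ h : (AdelicGroupData.gl 1 K).Adelic,
      ((detTwist 1 (1 : HeckeCharacter K) h : ℂˣ) : ℂ) = 1 := fun h => by
    rw [detTwist_apply, HeckeCharacter.one_apply, Units.val_one]
  -- (1) the local component at `v` is the trivial character `1 ∘ det` on `ℂ`
  let πv : SmoothIrrep (GL (Fin 1) (v.adicCompletion K)) := SmoothIrrep.ofQuasiChar 1
  have hloc : π.HasLocalComponentAt v (V := ℂ)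
      (glOneRep ((1 : QuasiChar (v.adicCompletion K)) : (v.adicCompletion K)ˣ →* ℂˣ)) := by
    refine ⟨LinearMap.toSpanSingleton ℂ ((AdelicGroupData.gl 1 K).Adelic → ℂ)
      (fun g => (detTwist 1 (1 : HeckeCharacter K) g : ℂ)), ?_, ?_, fun g x => ?_⟩
    · rw [hW, LinearMap.span_singleton_eq_range]
    · rw [hW']
      intro hle
      have h := hle (LinearMap.mem_range_self _ (1 : ℂ))
      rw [LinearMap.toSpanSingleton_apply_one, Submodule.mem_bot] at h
      have h1 := congrFun h 1
      rw [hd1, Pi.zero_apply] at h1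
      exact one_ne_zero h1
    · rw [hW', Submodule.mem_bot, LinearMap.toSpanSingleton_apply, LinearMap.toSpanSingleton_apply,
        map_smul, rightTranslation_detTwist_glOne, hd1, one_smul, sub_eq_zero]
      change ((((1 : QuasiChar (v.adicCompletion K)) (Matrix.GeneralLinearGroup.det g) : ℂˣ) : ℂ) • x) • _ = _
      simp
  -- (2) `rec_v(π_v)` is the trivial class: `gl_one` + rigidity of the trivial representation
  set L := Rec.llc v with hL
  have hgl := L.isLocalLanglands.gl_one 1 πv (SmoothIrrep.ofQuasiChar_ρ_apply 1)
  have hq : (WeilDeligneRep.ofQuasiChar L.hns L.artin (1 : QuasiChar (v.adicCompletion K))).IsEquivalent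
      (WeilDeligneRep.trivial ℂ ℂ) :=
    ⟨{ toRepEquiv := Representation.Equiv.mk (LinearEquiv.refl ℂ ℂ) fun w => LinearMap.ext fun z => by
        simp [WeilDeligneRep.trivial]
       comm_N := by simp [WeilDeligneRep.trivial] }⟩
  have hout : ((L.recGL 1 (IrrClass.mk πv)).out).1 = WeilDeligneRep.trivial ℂ (Fin 1 → ℂ) :=
    eq_trivial_of_isEquivalent_trivial (hgl.trans hq)
  have hcls : (WeilDeligneRep.trivial ℂ (Fin 1 → ℂ) :
      WeilDeligneRep (v.adicCompletion K) ℂ (Fin 1 → ℂ)).HasFrobSemisimpleClass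
        (L.recGL 1 (IrrClass.mk πv)) := by
    refine ⟨((L.recGL 1 (IrrClass.mk πv)).out).1, ?_, Quotient.out_eq _⟩
    rw [hout]
    exact (isFrobSemisimple_trivial 1).isFrobSemisimplificationOf_self
  -- (3) the trivial representation transports to the trivial representation
  have hunr : (1 : FramedGaloisRep K (PadicAlgCl ℓ) 1).IsUnramifiedAt v := fun _ _ _ _ => rfl
  have htriv : WeilDeligneRep.ofRep
      (((1 : FramedGaloisRep K (PadicAlgCl ℓ) 1).toLocal v).weilRestrict (v.adicCompletion K))
        (isLocallyUnramified_toLocal_of_isUnramifiedAt _ v hunr).isUnramifiedRep_weilRestrict.isContinuousRep =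
      WeilDeligneRep.trivial (PadicAlgCl ℓ) (Fin 1 → PadicAlgCl ℓ) := by
    refine eq_trivial_of_isEquivalent_trivial (W := Fin 1 → PadicAlgCl ℓ)
      ⟨{ toRepEquiv := Representation.Equiv.mk (LinearEquiv.refl _ _) fun w => LinearMap.ext fun x => ?_
         comm_N := by simp [WeilDeligneRep.trivial] }⟩
    simp only [LinearMap.coe_comp, Function.comp_apply, LinearEquiv.coe_coe, LinearEquiv.refl_apply,
      WeilDeligneRep.ofRep_ρ, FramedRep.weilRestrict_apply_apply, WeilDeligneRep.trivial,
      Representation.trivial_apply]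
    change Matrix.mulVec ((1 : GL (Fin 1) (PadicAlgCl ℓ)) : Matrix (Fin 1) (Fin 1) (PadicAlgCl ℓ)) x = x
    rw [Units.val_one, Matrix.one_mulVec]
  have htr : (WeilDeligneRep.trivial (PadicAlgCl ℓ) (Fin 1 → PadicAlgCl ℓ) :
      WeilDeligneRep (v.adicCompletion K) (PadicAlgCl ℓ) (Fin 1 → PadicAlgCl ℓ)).IsTransportAlong
        (ι : PadicAlgCl ℓ →+* ℂ) (WeilDeligneRep.trivial ℂ (Fin 1 → ℂ)) := by
    refine ⟨fun w => ?_, ?_⟩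
    · simp [WeilDeligneRep.trivial, Representation.trivial, Matrix.map_one _ (map_zero _) (map_one _)]
    · simp [WeilDeligneRep.trivial, Matrix.map_zero _ (map_zero _)]
  refine localGlobalCompatibleAt_above_of_isUnramifiedAt hF Rec ι π 1 hv hunr πv hloc
    (WeilDeligneRep.trivial ℂ (Fin 1 → ℂ)) ?_ hcls
  rw [htriv]
  exact htr

end Summit

end Summit.Langlands.Langlands.Theorems.ReciprocityUpToIrreducibility

end
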